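import Summits.BirchSwinnertonDyer.BirchSwinnertonDyer.Theses.TwistFamilyManinDescent
import Literature.NumberTheory.ModularSymbols.CuspidalHomologyHeckeModule

/-!
# Sketch — crux idea `type-truncated-optimal-curve` (TTOC) for
`TwistFamilyManinDescent.EisensteinAdditiveManinResidual` (stmt-BirchSwinnertonDyer-25138)

Statements only (no proofs, no `sorry`).  The instrument (`windowPeriods`, its p-old
specialisation `oldWindowPeriods`), the FIRST LEMMA `POldWindowManinBound` (T1: the
Česnavičius–Neururer–Saha bound `v_p(c) ≤ v_p(deg φ)` interpolated from `B = E` to any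
`K_e`-semistable Hecke-stable abelian subvariety `B ⊂ J₀(N)` containing the strong curve, here
`B = E + J₀(N)^{p-old}`), and the tame-row target `TameWindowRows`.  The unit statements of the
first draft (K1: `p ∤ ι_old`, resp. `p ∤ ι_type` for the maximal tame window) are REFUTED numerically at
`450b1` (kit j334651; see `CENSUS-ttoc-typewindow-g19.md`) and have been removed; T1 survives as an
instrument-grade upper bound `v_p(c) ≤ ℓ(λ_B)` that equals ČNS's on that row and BEATS it at
`1050d1` (`(5; IV)`, `m_E = 600`: maximal tame window `ι = 20 = [2,10]`, `ℓ = 1`, so `v₅(c) ≤ 1 < 2`).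
On all five computed Eisenstein tame rows `ℓ(λ_{J'_e}) = 1`: the revived line (T1 ∧ «p-exponent of
`Λ_f/P_{J'_e}` is `p`» ∧ «one crossed-type cusp form `g` with `ω_g ≡ ω_f (mod p·Cot 𝒥₀(N))`») is the
crux idea `tame-window-crossed-partner` (census v2 §4b).

Dictionary (analytic side, everything inside `S₂(Γ₀(N))^∨ ⊃ Λ = periodHomologyHecke N`):
an abelian subvariety `B ⊂ J₀(N)` is a `𝕋`-stable complex subspace `V_B ⊂ S₂^∨` with
`L_B = Λ ∩ V_B` a full lattice; `q|_B : B → E = ℂ/Λ_f` is `φ ↦ φ(f)` (`periodMap`), its image of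
`L_B` is the full-rank sublattice `P_B = periodMap f (L_B) ⊆ Λ_f`; `E''_B := B/(ker q|_B)⁰ = ℂ/P_B`
(the *B-optimal curve*), `λ_B : E''_B → E` the induced isogeny, `deg λ_B = [Λ_f : P_B]`.
For `B = q^∨E` one gets `λ_B = [m_E]`; for `B = J₀(N)`, `λ_B = id`.
-/

open scoped MatrixGroups ModularForm
open CongruenceSubgroup
open Literature.NumberTheory.EllipticCurves.ModularForms
open Literature.NumberTheory.ModularSymbols

namespace Summit.BirchSwinnertonDyer.BirchSwinnertonDyer.Cruxes.EisensteinAdditiveManinResidual.TypeTruncatedOptimalCurve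

/-- The `f`-eigen part `V_f ⊂ S₂(Γ₀(N))^∨` of the dual (transpose Hecke action): functionals `φ`
with `φ ∘ T = a_T(f) · φ` for every `T ∈ 𝕋_ℤ` of which `f` is an eigenvector (normalisation-free:
the eigenvalue is read off `f`).  `Λ ∩ V_f = H₁(q^∨E, ℤ)`. -/
noncomputable def eigenDual {N : ℕ} [NeZero N] (f : CuspForm (Gamma0 N) 2) :
    Submodule ℂ (Module.Dual ℂ (CuspForm (Gamma0 N) 2)) :=
  ⨅ (T : HeckeRing0 N 2), ⨅ (a : ℂ), ⨅ (_ : HeckeRing0.toEnd N 2 T f = a • f),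
    LinearMap.ker ((HeckeRing0.toEnd N 2 T).dualMap - a • LinearMap.id)

/-- The `p`-new cusp forms of level `N` (`p² ∣ N`): the joint kernel of the two trace (adjoint
degeneracy) maps to level `N/p` (Atkin–Lehner–Li). -/
noncomputable def pNewForms (N p : ℕ) [NeZero N] [NeZero (N / p)] [NeZero p] :
    Submodule ℂ (CuspForm (Gamma0 N) 2) :=
  LinearMap.ker (adjDegeneracyMap0 N (N / p) 1 2) ⊓ LinearMap.ker (adjDegeneracyMap0 N (N / p) p 2)

/-- The `p`-old part of the dual, `V^{p-old} = (S^{p-new})^⊥ = Σ_d im(Tr_d^∨)`: the complex subspace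
of `S₂(Γ₀(N))^∨` underlying the abelian subvariety `J₀(N)^{p-old} = Σ_{d ∈ {1,p}} π_d^* J₀(N/p)`.
Every constituent has conductor exponent `≤ 1` at `p`, hence is semistable over `ℚ_p`. -/
noncomputable def pOldDual (N p : ℕ) [NeZero N] [NeZero (N / p)] [NeZero p] :
    Submodule ℂ (Module.Dual ℂ (CuspForm (Gamma0 N) 2)) :=
  (pNewForms N p).dualAnnihilator

/-- **Instrument (c-free).** The `f`-periods of the WINDOW `Λ ∩ (V_f + V)` for a complex subspace
`V ⊂ S₂(Γ₀(N))^∨`: the sublattice `P_B ⊆ Λ_f = periodLattice f` whose index is `deg λ_B`, for the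
abelian subvariety `B` with `V_B = V_f + V`.  Computable from modular symbols alone. -/
noncomputable def windowPeriods (N : ℕ) [NeZero N] (f : CuspForm (Gamma0 N) 2)
    (V : Submodule ℂ (Module.Dual ℂ (CuspForm (Gamma0 N) 2))) : AddSubgroup ℂ :=
  AddSubgroup.closure ((periodMap N f) ''
    {x : periodHomologyHecke N |
      (x : Module.Dual ℂ (CuspForm (Gamma0 N) 2)) ∈ eigenDual f ⊔ V})

/-- The `p`-OLD WINDOW periods `P(f; Λ ∩ (V_f + V^{p-old}))` — the smallest type window; its index
`ι_old(f) = [Λ_f : P]` is the degree of `λ : E''_{E + J^{p-old}} → E`. -/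
noncomputable def oldWindowPeriods (N p : ℕ) [NeZero N] [NeZero (N / p)] [NeZero p]
    (f : CuspForm (Gamma0 N) 2) : AddSubgroup ℂ :=
  windowPeriods N f (pOldDual N p)

/-- **T1 (first lemma; `POldWindowManinBound`).**  `W/ℚ` globally minimal, STRONG Weil
(`Λ_E = c · Λ_f`), `p ≥ 5`, `p² ∣ N`, potentially good at `p` with
`e = 12/gcd(12, v_pΔ) < p − 1`.  Then `v_p(c_E) ≤ v_p [Λ_f : P(f; Λ ∩ (V_f + V^{p-old}))]`.
Proof sketch (three named inputs): (i) Česnavičius–Neururer–Saha: `ω_f ∈ H⁰(𝒥₀(N)_{ℤ_(p)}, Ω¹)`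
(`p ≥ 5`, rational singularities), hence `ω_f|_B ∈ H⁰(ℬ, Ω¹)` by Néron functoriality of `B ↪ J₀(N)`;
(ii) `B = q^∨E + J₀(N)^{p-old}` is semistable over `K_e = ℚ_p(ζ_e, p^{1/e})`, `e(K_e) = e < p − 1`,
so BLR 7.5.4 / Mazur 1978 Cor. 1.1 gives `Lie ℬ_{O_K} ↠ Lie ℰ''_{O_K}` for `B ↠ E''_B` (connected
kernel); (iii) Edixhoven 1992 (tame descent, `𝒜_{ℤ_p} = (Res 𝒜_{O_K})^G`, `|G|` prime to `p`) descends
the surjection to `ℤ_p`, so `ψ_B^* ω_{E''}` is primitive in `H⁰(ℬ, Ω¹)`.  Writing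
`λ_B^* ω_E = u p^{ℓ} ω_{E''}` and `c · ω_f|_B = ψ_B^* λ_B^* ω_E` gives `v_p(c) = ℓ(λ_B) − b ≤ ℓ(λ_B)`
(`b ≥ 0` the divisibility of `ω_f|_B`), and `ℓ(λ_B) ≤ v_p(deg λ_B) = v_p(ι)`.  For `B = q^∨E` this is
literally ČNS's `v_p(c) ≤ v_p(deg φ)`.  (Guarded by `ι ≠ 0`, i.e. the window has full rank, which
holds since `V_f ⊆ V_f + V`.) -/
def POldWindowManinBound : Prop :=
  ∀ (W : WeierstrassCurve ℚ) [W.IsElliptic] [W.IsGloballyMinimal] (p : ℕ) [Fact p.Prime] [NeZero p]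
    [NeZero (W.conductorNorm ℤ)] [NeZero (W.conductorNorm ℤ / p)]
    (D : ModularParametrizationData W (W.conductorNorm ℤ)),
    5 ≤ p → p ^ 2 ∣ W.conductorNorm ℤ → 0 ≤ padicValRat p W.j →
    12 / Nat.gcd 12 (padicValInt p W.minimalDiscriminantInt) < p - 1 →
    (∀ z ∈ D.L.lattice, ∃ w ∈ periodLattice D.f, z = D.c * w) →
    (oldWindowPeriods (W.conductorNorm ℤ) p D.f).relIndex (periodLattice D.f) ≠ 0 →
    padicValInt p D.maninConstant ≤
      padicValNat p ((oldWindowPeriods (W.conductorNorm ℤ) p D.f).relIndex (periodLattice D.f))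

/-- **Target of the (dead) sub-line, kept as the honest statement of what T1 was aimed at.**  The crux
restricted to its TAME rows (`e = 12/gcd(12, v_pΔ) < p − 1`: `(5; IV, IV*)`, `(7; IV, IV*, III, III*)`,
`(13; all)`, …): strong, globally minimal, `E[p]` reducible ⇒ `p ∤ c`.  It contains K15b
(`SupersingularUnstarredStrongManinUnit`, stmt-27071) row-wise.  NEGATIVE KNOWLEDGE (kit j334651,
2026-08-29): the intended mechanism `T1 ∧ (p ∤ ι_window)` is DEAD on the row family `(5; IV)`: for the
strong curve `450b1` (`IV` at 5, `E[5]` reducible, `m_E = 60`) the `p`-old window has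
`ι_old = 400 = [20, 20]` and the maximal tame (type-`SC₃`) window has `ι = 20`, Smith `[2, 10]`, so
`λ_B` factors through the cyclic 5-isogeny `450b3 (IV*) → 450b1` with `ℓ = 1` and T1 returns exactly the
ČNS bound `v₅(c) ≤ 1`; the missing power of 5 is `b_B(f) = 1` (`ω_f|_B ∈ 5 · Cot(ℬ)`), i.e. input beyond
{ČNS integrality on `𝒥₀(N)`, Raynaud–Mazur exactness over the tame field, Edixhoven tame descent} is
load-bearing on these rows.  Do NOT file `p ∤ ι_old` / `p ∤ ι_type` as statements: both are false at
`450b1` (and at `1050d1`, where nevertheless T1 improves ČNS by one). -/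
def TameWindowRows : Prop :=
  ∀ (W : WeierstrassCurve ℚ) [W.IsElliptic] [W.IsGloballyMinimal] (p : ℕ) [Fact p.Prime] [NeZero p]
    [NeZero (W.conductorNorm ℤ)] [NeZero (W.conductorNorm ℤ / p)]
    (D : ModularParametrizationData W (W.conductorNorm ℤ)),
    5 ≤ p → p ^ 2 ∣ W.conductorNorm ℤ → 0 ≤ padicValRat p W.j →
    12 / Nat.gcd 12 (padicValInt p W.minimalDiscriminantInt) < p - 1 →
    ¬ W.HasIrreducibleModPGaloisRep p →
    (∀ z ∈ D.L.lattice, ∃ w ∈ periodLattice D.f, z = D.c * w) →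
    ¬ (p : ℤ) ∣ D.maninConstant

end Summit.BirchSwinnertonDyer.BirchSwinnertonDyer.Cruxes.EisensteinAdditiveManinResidual.TypeTruncatedOptimalCurve
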